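/- Copyright: the b2b-balaban cell (near-miss cell 7), T⁴-continuum fan-out; row NE7b CRUX team (2), seat
t4-ne7b-formalise-leaf-03 (gen 26) — custodian's PRE-BUILD of the OWNER's SPEC IR-46-2 «THE (α) ASSEMBLY» v0
(`HOME/t4/b2b-balaban-t4-ne7b-p1/g46/SPEC-IR-46-2-ASSEMBLY.v0.md`, journal l.31761 ∕ answers l.31857) made IR-46-2 PROPER by RULING
R-OWNER-47-2 (journal l.31988), part 2 of 2: the witness and the headline corollary.  Released under the licence of the surrounding project. -/
import Summits.QuantumFields.BalabanUV.T4Continuum.Support.HistoryRealiseCellsRunAssemblyWTVSData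
import Summits.QuantumFields.BalabanUV.T4Continuum.Support.HistoryRealiseCellsRunHeadlineT3bWTVS

/-!
# THE (α) ASSEMBLY, part 2: THE VS-WITNESS `CountRoadWitnessT3bWTVS` INHABITED FROM M2 BRICK B's READING OF (1.72)
(re-open object (α) of row NE7b; SPEC IR-46-2 v0 §1∕§3; lineage `t4-ne7b-formalise-leaf-03` gen 26, custodian of the S12-W crew)

Summits-side support leaf of the T⁴-continuum cell (rung (B)+1 on a FINITE torus only; NOT infinite volume, NOT the
mass gap, NOT the Clay statement; NOT a proof of the spine estimate NE7b — the cell's OWN estimate, NOT PRINTED, NOT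
PROVED).  [folklore] composition BY NAME, field by field, of the S12-W crew's and the owner's modules into the witness
shape `HistoryRealiseCellsRunApexT3bWTVS.CountRoadWitnessT3bWTVS` (leaf-02, p265435); no definition, no `[cite:]` tag,
nothing printed asserted, no `Prop` fact minted, zero `sorry`.  THE ASSEMBLY PROVES NOTHING OF BAŁABAN's: it makes the
WALL's R∕S-list LITERALLY the hypothesis list (`HistReadData` + the flow) of ONE kernel theorem.

WHAT.  **`nonempty_countRoadWitnessT3bWTVS_of_histReading`** (R-OWNER-47-2's decl : type): from the bundled inputs
`HistReadData` (part 1) ALONE, `Nonempty (CountRoadWitnessT3bWTVS D C O θᵥ rr d n hn g₀ os (HIndex.Idx I) (ℕ × Lab d) (Lab d))`,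
by SPEC §3's table:
`T := termSet I`, `A K t := weight μ RA t`, `reprA` := `H2A` ∘ M2-A `integral_eq_sum_weight`; `R := ℛ.R`; `ped`∕`cellP`∕
`liveC`∕`Zd` := `ℛ.inputOf.pedV` ∕ `id` ∕ `liveCV` ∕ `ZV`; `realised` := JunctionV `realisedDomainsRW_of_familyV` transported
along (c1)'s `ℛ.L = F.L`, `ℛ.s = runProfile F.L ℛ.R`; `step_le` := `le_rfl` ((c5): live names are `(K, x)`,
`pedOf.step := Prod.fst`); `disjointJoins`∕`boxedBirths` := the displayed `hDJ`∕`hBB` ((c5)(i)); `FcM K := LIVEOf C K (ℛ.R K)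
(uV K) (sharpT (sB K) (sR K))`, `RfM K := MULTOf (sharpT (φB K) (φR K))`, `uV K n := 2^{d+3}·log (Φf.Λ K n)`; `priceM` :=
`priceM_of_reading`, `upM` := `upM_of_reading′`, `deadM_nonneg` := `deadM_nonneg_of_reading`, `resumM` := `resumM_of_reading`
∘ (ρ), `FM_nonneg` := `FM_nonneg_of_reading` (the sibling `HistoryRealiseCellsRunSupplyKeysWTVS`), `dead := deadOf ℛ Φf W`,
`nup := nupOf Φf mass W`, `Nup := e^{BA∞}·m∞·W∞`, `nup_bd` := `nupOf_le`; the root-cell injectivity the suppliers want is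
`cellOfR_injOn_W` on `realised` with the flow's K-facts `hprof`∕`hdrop` ((c3): `realised` first); RUN B v0.5 (R-OWNER-47-2
(A)(iii)): `A′ := weightB ν RB trunc`, `reprB` := `H2B` ∘ the owner's M2-C `reprB_of_holds_trunc`, `dead′ := aggW trunc … dB`,
`upM′`∕`deadM′_nonneg`∕`resumM′` := M2-C `upM'_of_trunc` ∕ `deadM'_nonneg_of_trunc` ∕ `resumM'_of_trunc` on the displayed run-B
readings keyed at run A's keys and (ρ′), `FcM′ K := LIVEOf C K (ℛ.R K) (uV K) (sharpT (sB′ K) (sR′ K))`, `RfM′ K := MULTOf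
(sharpT (φB′ K) (φR′ K))`, `priceM′` := `priceM_of_reading` at run B's letters (same members, same run-A price), `FM′_nonneg` :=
`FM_nonneg_of_reading`; NE7c, NE7, (γ)∕sites := the displayed fields.  `[DecidableEq (HIndex.Idx I)]` is BOUND by the theorem
((c7) as ruled) and discharged only in the corollary: **`continuumYM4Torus_of_histReading_fsc`** = the VS-headline of record
`HistoryRealiseCellsRunHeadlineT3bWTVS.continuumYM4Torus_of_countRoadT3bWTVS_fsc` (p266167) with its `hData` supplied, for all
small couplings and every loop string, by SOME reading `HistReadData …` (skeletons, spaces, measures existentially) —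
`ForSmallCouplings.mono` ∘ the theorem.

HONEST SCOPE.  The R-list of (α) after this theorem = `HistReadData`'s displays: `holdsA`∕`intA`∕`H2A` and `holdsB`∕`intB`∕`H2B`
((1.72)-holds + H2, both runs), `HistRead` (THE identification), pass-V input conditions, `isRj` + the flow's K-facts, volume
calibrations + `huV`, `FactorRead`, `RoundingRoomF` (both runs' letters), `FlowIneq29`, (ρ) `FibreMass` and (ρ′), `W∞`∕`BA∞`∕`m∞`,
(γ)∕sites, `hDJ`∕`hBB` (until IR-47-1), run B's numerator readings keyed at run A's keys «TRUNC»; S: `trunc` + `MapsTo` (NODE O),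
NE7c `shell`, NE7 `budget` + rates.  NE7b NOT proved; spine 0∕9.  HONEST DEPENDENCY (cell): continuum YM on T⁴ ⇐
BetaPertH ∧ nine spine estimates (0/9 proved); BetaPertH ⇐ (D1) ∧ (D4) ∧ CAP+tail; G-an2-4 gates asym, D1 and NE2/3/4.
This file changes none of it.
SUPERSESSION-OF-RECORD MARKING (v1.1, owner gen 53, DOCSTRING ONLY — every declaration, binder, proof, `import` and `open`
line of v1 = p281050 byte-identical; referee OI-77 «FILE 2»; R-OWNER-48-1 «THE GUARDED CUT»).  SUPERSEDED IN PLACE FOR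
INHABITATION: `nonempty_countRoadWitnessT3bWTVS_of_histReading` ∕ `continuumYM4Torus_of_histReading_fsc` consume the record
`HistReadData` (part 1), whose display `hDJ` is typed in the UNGUARDED currency `HistoryRealiseDistinct.DisjointJoins` —
MISSTATED AS TYPED (unsatisfiable for any reading with a live join: `HistoryRealiseDistinctGuarded.Sanity.not_disjointJoins_nestedToy`;
inhabited only by the no-region toy `nonempty_histReadData_toyData` p288154), so `hRead` here is not an honest hypothesis.  OF
RECORD INSTEAD: the guarded chain L1–L5 — record `HistReadDataL` (p283718; `hDJ`∕`hBB` dropped, input display `hreg`), witness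
`CountRoadWitnessT3bWTVSL` (p283603), headline `…HeadlineT3bPWTVSL` (p285957), assembly `HistoryRealiseCellsRunAssemblyWTVSL`
(p287559: `nonempty_countRoadWitnessT3bWTVSL_of_histReadingL`, `continuumYM4Torus_of_histReadingL_fsc`, and `HistReadData.toL`
re-deriving THIS file's §1 through the guarded road) — and its descendants `HistReadDataLW`∕`LWD`∕`LWK`∕`LP` (records p289955 ∕ p294821 ∕
p297996 ∕ p299868; assemblies p290621 ∕ p295979 ∕ p298331 ∕ p300321).  The two theorems below stay TRUE and in the tree, unused by the road of record.
-/

open Finset MeasureTheory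
open Literature.MathematicalPhysics.QuantumFieldTheory.Balaban1983to89
open T4PersistenceDictionary T4PersistentHistoryCount T4BankedInduction T4PrintedShapeBanking
open T4WeightBudget T4GlobalDenominator T4LiveClassFibration T4LiveStructureGas T4LiveGasToTerms T4RecordPriceSeam
open T4PartnerMultiplicity T4IndicatorShell T4MatchingAssembly T4MatchingClosure T4MatchingClosureSocket T4Continuum
open T4StabilitySocket T4BranchingRecordsGas T4TaggedShapeBanking T4CanonicalMenus T4RenewalChains
open Summit.QuantumFields.BalabanUV.T4Continuum.PlacementBatch Summit.QuantumFields.BalabanUV.T4Continuum.PlacementSkeleton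
open Summit.QuantumFields.BalabanUV.T4Continuum.CountThresholdUniform Summit.QuantumFields.BalabanUV.T4Continuum.CountThresholdExit
open Summit.QuantumFields.BalabanUV.T4Continuum.CountSeamJunction Summit.QuantumFields.BalabanUV.T4Continuum.LateMergers
open Summit.QuantumFields.BalabanUV.T4Continuum.HistoryFlow Summit.QuantumFields.BalabanUV.T4Continuum.HistoryRegeneration
open Summit.QuantumFields.BalabanUV.T4Continuum.HistoryTables Summit.QuantumFields.BalabanUV.T4Continuum.HistoryAssemblyTrees
open Summit.QuantumFields.BalabanUV.T4Continuum.HistoryAssemblyTerms Summit.QuantumFields.BalabanUV.T4Continuum.HistoryAssemblyPedigree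
open Summit.QuantumFields.BalabanUV.T4Continuum.HistoryConstants Summit.QuantumFields.BalabanUV.T4Continuum.HistoryGen
open Literature.MathematicalPhysics.QuantumFieldTheory.Balaban1983to89.B13ScaleTransfer
open Summit.QuantumFields.BalabanUV.T4Continuum.ZoneSkeleton Summit.QuantumFields.BalabanUV.T4Continuum.HistorySocketTH
open Summit.QuantumFields.BalabanUV.T4Continuum.HistoryCaps Summit.QuantumFields.BalabanUV.T4Continuum.HistoryAssemblyPrice
open Summit.QuantumFields.BalabanUV.T4Continuum.HistoryBankingLE Summit.QuantumFields.BalabanUV.T4Continuum.HistoryExitLE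
open Summit.QuantumFields.BalabanUV.T4Continuum.HistoryAssemblyTreesLE Summit.QuantumFields.BalabanUV.T4Continuum.HistoryAssemblyTermsLE
open Summit.QuantumFields.BalabanUV.T4Continuum.HistoryRealise Summit.QuantumFields.BalabanUV.T4Continuum.HistoryAssemblyRealiseLE
open Summit.QuantumFields.BalabanUV.T4Continuum.HistoryAssemblyMult Summit.QuantumFields.BalabanUV.T4Continuum.HistoryAssemblyMultKey
open Summit.QuantumFields.BalabanUV.T4Continuum.HistoryAssemblyRealiseRun Summit.QuantumFields.BalabanUV.T4Continuum.HistoryAssemblyRealiseMult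
open Summit.QuantumFields.BalabanUV.T4Continuum.HistoryZones Summit.QuantumFields.BalabanUV.T4Continuum.HistoryRealiseCells
open Summit.QuantumFields.BalabanUV.T4Continuum.HistoryRealiseCellsRun Summit.QuantumFields.BalabanUV.T4Continuum.HistoryAssemblyRealiseRunMult
open Summit.QuantumFields.BalabanUV.T4Continuum.HistoryRealiseCellsRunMult Summit.QuantumFields.BalabanUV.T4Continuum.HistoryAssemblyMultInstance
open Summit.QuantumFields.BalabanUV.T4Continuum.HistoryJoinsPlacedMember Summit.QuantumFields.BalabanUV.T4Continuum.PlacementSkeleton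
open Summit.QuantumFields.BalabanUV.T4Continuum.HistoryJoinsPlacedMult Summit.QuantumFields.BalabanUV.T4Continuum.HistoryRealiseDistinct
open Summit.QuantumFields.BalabanUV.T4Continuum.HistoryRegionTemplates Summit.QuantumFields.BalabanUV.T4Continuum.HistoryCaps
open Summit.QuantumFields.BalabanUV.T4Continuum.HistoryZoneEvolve (cth)
open Literature.MathematicalPhysics.QuantumFieldTheory.Balaban1983to89.B16SProfile (DropCtl)
open Summit.QuantumFields.BalabanUV.T4Continuum.HistoryRealiseCellsRunMultEnd Summit.QuantumFields.BalabanUV.T4Continuum.HistoryRealiseCellsRunMultEndD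
open Summit.QuantumFields.BalabanUV.T4Continuum.HistoryRealiseCellsRunPinnedT3b Summit.QuantumFields.BalabanUV.T4Continuum.HistoryHybridRescale
open Summit.QuantumFields.BalabanUV.T4Continuum.HistoryRealiseCellsRunApex (exists_const_schemeZ)
open Summit.QuantumFields.BalabanUV.T4Continuum.HistoryRealisePrint Summit.QuantumFields.BalabanUV.T4Continuum.HistoryRealiseWeak
open Summit.QuantumFields.BalabanUV.T4Continuum.HistoryRealisePrintReading Summit.QuantumFields.BalabanUV.T4Continuum.HistoryRealiseWeakReading
open Summit.QuantumFields.BalabanUV.T4Continuum.HistoryRealisePrintCells Summit.QuantumFields.BalabanUV.T4Continuum.HistoryRealiseWeakCells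
open Summit.QuantumFields.BalabanUV.T4Continuum.HistoryRealiseCellsRunApexT3b Summit.QuantumFields.BalabanUV.T4Continuum.HistoryRealiseCellsRunApexT3bW

open Summit.QuantumFields.BalabanUV.T4Continuum.HistoryRealiseCellsRunApexT3bWT Summit.QuantumFields.BalabanUV.T4Continuum.HistoryRealiseCellsRunPinnedT3bWT
open Summit.QuantumFields.BalabanUV.T4Continuum.HistoryRealiseCellsRunHeadlineT3bWT
open Summit.QuantumFields.BalabanUV.T4Continuum.HistoryRealiseCellsRunApexT3bWTV Summit.QuantumFields.BalabanUV.T4Continuum.HistoryBankingVolumePlug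
open Summit.QuantumFields.BalabanUV.T4Continuum.HistoryRealiseCellsRunApexT3bWTVS
open Summit.QuantumFields.BalabanUV.T4Continuum.HistoryGenealogyRealise
open Summit.QuantumFields.BalabanUV.T4Continuum.HistoryGenealogyInstantiate
open Summit.QuantumFields.BalabanUV.T4Continuum.B16HistoryIndexedRepr
open Summit.QuantumFields.BalabanUV.T4Continuum.HistoryBankingDiscountCharge
open Summit.QuantumFields.BalabanUV.T4Continuum.HistoryBankingCreditRead
open Summit.QuantumFields.BalabanUV.T4Continuum.HistoryBankingFibreRoom
open Summit.QuantumFields.BalabanUV.T4Continuum.HistoryPriceKeys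
open Summit.QuantumFields.BalabanUV.T4Continuum.HistoryRealiseCellsRunSupplyWTVS
open Summit.QuantumFields.BalabanUV.T4Continuum.HistoryRealiseCellsRunSupplyKeysWTVS
open Summit.QuantumFields.BalabanUV.T4Continuum.HistoryRealiseCellsRunAssemblyWTVSData
open Summit.QuantumFields.BalabanUV.T4Continuum.HistoryRealiseWeakCells
open Summit.QuantumFields.BalabanUV.T4Continuum.B16HistoryIndexedTrunc
open Summit.QuantumFields.BalabanUV.T4Continuum.HistoryRealiseCellsRunHeadlineT3bWTVS

namespace Summit.QuantumFields.BalabanUV.T4Continuum.HistoryRealiseCellsRunAssemblyWTVS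

noncomputable section

set_option synthInstance.maxSize 1024

section Assembly

variable {F : T4Family} {G : Type*} [GaugeGroup G] [MeasurableSpace G] [HaarData G] [RegularGaugeGroup G]

omit [RegularGaugeGroup G] in
/-- **THE (α) ASSEMBLY — THE VS-WITNESS INHABITED FROM M2 BRICK B's READING OF (1.72)** (IR-46-2 proper, R-OWNER-47-2 (A)):
from the bundled inputs `HistReadData` (data + located displays, NOTHING of Bałaban's asserted),
`Nonempty (CountRoadWitnessT3bWTVS D C O θᵥ rr d n hn g₀ os (HIndex.Idx I) (ℕ × Lab d) (Lab d))`.  Every H3 numerator field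
of BOTH runs has its NAMED supplier (crew + owner: the sibling's `priceM_of_reading` ∕ `upM_of_reading'` ∕
`resumM_of_reading` ∕ `FM_nonneg_of_reading`, part 2's `deadM_nonneg_of_reading` ∕ `nupOf_le`, M2-A's
`integral_eq_sum_weight`, M2-C's `reprB_of_holds_trunc` ∕ `upM'_of_trunc` ∕ `deadM'_nonneg_of_trunc` ∕ `resumM'_of_trunc`,
JunctionV's `realisedDomainsRW_of_familyV`); NE7c, NE7 and the reading's displays pass through. [folklore] -/
theorem nonempty_countRoadWitnessT3bWTVS_of_histReading {D : FiniteEpsData F G} {C : T4PrintedShapeBanking.Consts}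
    {O : PrintedO1s} {θv : ℝ} {rr d n : ℕ} {hn : 0 < n} {g₀ : ℕ → ℝ} {os : List (ULoop F)} {DomK : ℕ → Type}
    {I : (K : ℕ) → HIndex (DomK K)} [DecidableEq (HIndex.Idx I)] {DomK' : ℕ → Type} {I' : (K : ℕ) → HIndex (DomK' K)}
    {X : ℕ → Type} [∀ K, MeasurableSpace (X K)] {μ : (K : ℕ) → Measure (X K)} [∀ K, IsFiniteMeasure (μ K)]
    {𝒢 : (K : ℕ) → GoodClass (X K)} {Y : ℕ → Type} [∀ K, MeasurableSpace (Y K)] {νB : (K : ℕ) → Measure (Y K)}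
    [∀ K, IsFiniteMeasure (νB K)] {𝒢' : (K : ℕ) → GoodClass (Y K)}
    (Dd : HistReadData D C O θv rr d n hn g₀ os I I' X μ 𝒢 Y νB 𝒢') :
    Nonempty (CountRoadWitnessT3bWTVS D C O θv rr d n hn g₀ os (HIndex.Idx I) (ℕ × Lab d) (Lab d)) := by
  obtain ⟨l₀, vol, l₀_pos, vol_pos, K₀, RA, ρA, holdsA, intA, H2A, ℛ, hL, hs, Φf, hR, isRj, one_le_R, hL4, hprof, hdrop,
    hN, hRm, hRmS, hRm2, hD, hbox, hn₁, hE₂, hE₃, Lu, jl, hLu0, hj1, hLu, hsmall, huΦ, huE₂, huE₃, sB, sR, φB, φR, β', β₀,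
    hF, hRR, h29, huV, W, one_le_W, Wi, BAi, mi, hWi, hBA, hmi, hρ, c₀, n₁, c₀_pos, floor, floor', sites, sites', hDJ, hBB,
    RB, ρB, holdsB, intB, H2B, trunc, htr, dB, mup, sB', φB', sR', φR', hRR', upB, deadB_nonneg, resumB, mup_bd, shA, shB,
    Wsh, shell, Cc, Rr, CcRec, RrRec, ν, u, s₂, q₀, r, s, budget, sum_r, sum_u, sum_s, sum_s₂⟩ := Dd
  -- the flow's letters at the reading
  have hL0 : 0 < F.L := lt_of_lt_of_le (by norm_num) (two_le_L F)
  have hL1 : 1 ≤ F.L := le_trans (by norm_num) (two_le_L F)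
  have hL0' : 0 < ℛ.L := by rw [hL]; exact hL0
  have hL4' : 4 ≤ ℛ.L := by rw [hL]; exact hL4
  have hdrop' : ∀ K, K₀ ≤ K → ∀ m, DropCtl (ℛ.s K) m := by rw [hs]; exact hdrop
  have hWpos : ∀ K, 0 < W K := fun K => lt_of_lt_of_le one_pos (one_le_W K)
  have hmass : ∀ K, 0 ≤ (μ K).real Set.univ := fun K => measureReal_nonneg
  -- (c3): `realised` first (JunctionV, transported along (c1)'s equations), then the root-cell injectivity
  have realised : RealisedDomainsRW F.L (runProfile F.L ℛ.R) n K₀ ℛ.R (HIndex.termSet I) ℛ.inputOf.pedV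
      (fun _ _ => id) ℛ.inputOf.liveCV ℛ.inputOf.ZV := by
    have h0 : RealisedDomainsRW ℛ.L ℛ.s n K₀ ℛ.R (HIndex.termSet I) ℛ.inputOf.pedV (fun _ _ => id) ℛ.inputOf.liveCV
        ℛ.inputOf.ZV :=
      ℛ.inputOf.realisedDomainsRW_of_familyV (HIndex.termSet I) n K₀ hN hRm hRmS hRm2 hD hL0' hbox
    rw [hL, hs] at h0
    exact h0
  have hinj : ∀ K, K₀ ≤ K → ∀ τ ∈ HIndex.termSet I K,
      Set.InjOn (cellOfR n F.L (runProfile F.L ℛ.R) ℛ.inputOf.pedV (fun _ _ => id) K τ)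
        (ℛ.inputOf.liveCV K τ : Set (ℕ × Lab d)) :=
    fun K hK τ hτ => cellOfR_injOn_W hL0 realised hK (hprof K hK) (hdrop K hK K) hτ
  refine ⟨{
    l₀ := l₀, vol := vol, l₀_pos := l₀_pos, vol_pos := vol_pos, K₀ := K₀, T := HIndex.termSet I,
    A := fun _ t => Repr172R.weight μ RA t, A' := weightB νB RB trunc, shA := shA, shB := shB,
    dead := fun K t τ => deadOf ℛ Φf W K t τ, dead' := aggW trunc (fun K => HIndex.termSet I' (K + 1)) dB,
    nup := nupOf Φf (fun K => (μ K).real Set.univ) W, mup := mup, Nup := Real.exp BAi * mi * Wi,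
    Cc := Cc, Rr := Rr, CcRec := CcRec, RrRec := RrRec, ν := ν, u := u, s₂ := s₂, q₀ := q₀, r := r, s := s, Wsh := Wsh,
    reprA := fun K t ht hK =>
      (H2A K t ht hK).trans (Repr172R.integral_eq_sum_weight μ RA K t (ρA K t) (holdsA K t) (intA K t)),
    reprB := fun K t ht hK =>
      (H2B K t ht hK).trans (reprB_of_holds_trunc νB RB trunc K (fun t => ∫ y, ρB K t y ∂νB (K + 1)) (ρB K)
        (fun _ => rfl) (holdsB K) (intB K) (htr K hK) t),
    c₀ := c₀, n₁ := n₁, c₀_pos := c₀_pos, floor := floor, floor' := floor', sites := sites, sites' := sites',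
    Nup_nonneg := mul_nonneg (mul_nonneg (Real.exp_pos _).le ((hmass 0).trans (hmi 0)))
      (zero_le_one.trans ((one_le_W 0).trans (hWi 0))),
    nup_bd := fun K t ht hK => ⟨nupOf_measure_nonneg Φf μ (fun K => (hWpos K).le) K t,
      nupOf_le Φf (hmass K) (hWpos K).le (hBA K t ht hK) (hmi K) (hWi K)⟩,
    mup_bd := mup_bd, R := ℛ.R, isRj := isRj, one_le_R := one_le_R,
    ped := ℛ.inputOf.pedV, cellP := fun _ _ => id, liveC := ℛ.inputOf.liveCV, Zd := ℛ.inputOf.ZV,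
    realised := realised,
    step_le := fun K _ τ _ c hc => by
      obtain ⟨x, -, rfl⟩ := Finset.mem_image.1 hc
      exact le_rfl,
    disjointJoins := hDJ, boxedBirths := hBB,
    FcM := fun K k => LIVEOf C K (ℛ.R K) (fun m => 2 ^ (d + 3) * Real.log (Φf.Λ K m)) (sharpT (sB K) (sR K)) k,
    RfM := fun K k => MULTOf (sharpT (φB K) (φR K)) k,
    FcM' := fun K k => LIVEOf C K (ℛ.R K) (fun m => 2 ^ (d + 3) * Real.log (Φf.Λ K m)) (sharpT (sB' K) (sR' K)) k,
    RfM' := fun K k => MULTOf (sharpT (φB' K) (φR' K)) k,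
    uV := fun K m => 2 ^ (d + 3) * Real.log (Φf.Λ K m), huV := huV,
    priceM := fun K t _ hK τ hτ =>
      priceM_of_reading ℛ Φf (hN K hK) (hRm K hK) (hRmS K hK) (hRm2 K hK) (hD K hK) hL0' hL4' (hdrop' K hK)
        (one_le_R K hK) hn₁ hE₂ hE₃ (hRR K hK) (h29 K hK) hL1 _ _ (hinj K hK) jhalf τ hτ,
    priceM' := fun K t _ hK τ hτ =>
      priceM_of_reading ℛ Φf (hN K hK) (hRm K hK) (hRmS K hK) (hRm2 K hK) (hD K hK) hL0' hL4' (hdrop' K hK)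
        (one_le_R K hK) hn₁ hE₂ hE₃ (hRR' K hK) (h29 K hK) hL1 _ _ (hinj K hK) jhalf τ hτ,
    upM := fun K t ht hK =>
      upM_of_reading' ℛ Φf μ RA hR hK ht (hN K hK) (hRm K hK) (hRmS K hK) (hRm2 K hK) (hD K hK) hL0' hL4'
        (hdrop' K hK) (one_le_R K hK) hn₁ hE₂.le hE₃ (hLu0 K hK) (hj1 K hK) (hLu K hK) (hsmall K hK) (huΦ K hK)
        (huE₂ K hK) (huE₃ K hK) (hF K hK) (hWpos K) _ _ (hinj K hK) jhalf,
    deadM_nonneg := fun K t _ hK =>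
      deadM_nonneg_of_reading ℛ Φf (hF K hK).fB_nonneg (hF K hK).fR_nonneg (hWpos K).le t _ _ jhalf,
    resumM := fun K t ht hK => resumM_of_reading ℛ Φf (hWpos K) t _ _ jhalf (φB K) (φR K) (hρ K t ht hK),
    FM_nonneg := fun K t _ _ => FM_nonneg_of_reading ℛ C K (ℛ.R K) _ _ _ _ jhalf,
    upM' := fun K t ht hK k hk =>
      upM'_of_trunc (fun K k => LIVEOf C K (ℛ.R K) (fun m => 2 ^ (d + 3) * Real.log (Φf.Λ K m))
        (sharpT (sB' K) (sR' K)) k) mup (upB K t ht hK k hk),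
    deadM'_nonneg := fun K t ht hK k hk => deadM'_nonneg_of_trunc (deadB_nonneg K t ht hK k hk),
    resumM' := fun K t ht hK k hk =>
      resumM'_of_trunc (fun K k => MULTOf (sharpT (φB' K) (φR' K)) k) (resumB K t ht hK k hk),
    FM'_nonneg := fun K t _ _ => FM_nonneg_of_reading ℛ C K (ℛ.R K) _ _ _ _ jhalf,
    shell := shell, budget := budget, sum_r := sum_r, sum_u := sum_u, sum_s := sum_s, sum_s₂ := sum_s₂ }⟩

end Assembly

/-! ## The headline corollary: the VS-headline of record with `hData` supplied by SOME reading, for all small couplings -/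

section SU

variable {F : T4Family} {N : ℕ} [NeZero N] {ℰ : LoopAverage (Matrix.specialUnitaryGroup (Fin N) ℂ)}

/-- **THE HEADLINE PREDICATE FROM A READING OF (1.72)** (IR-46-2 proper, R-OWNER-47-2 (A), over the v3′ VS-headline NOW):
`T4ContinuumYM4Torus.ContinuumYM4Torus D` for (0.4)-block-averaged data on `SU(N)` with a measurable small-loop average,
GIVEN the two pins `(B)` and `BetaPertHyp` BY NAME, the datum's sign conventions, END v3′'s constants-only side conditions
with the split slack `C.a + (θ + θᵥ) ≤ ½γ₀A₁²`, and — for all small-coupling tuned runs and every loop string — SOME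
reading `HistReadData D C O θᵥ rr d n hn g₀ os I I′ X μ 𝒢 Y ν 𝒢′` of the two runs' (1.72) expansions (skeletons, spaces,
measures existentially; its displays are THE R∕S-LIST of (α)).  `HistoryRealiseCellsRunHeadlineT3bWTVS.
continuumYM4Torus_of_countRoadT3bWTVS_fsc` ∘ `ForSmallCouplings.mono` ∘ `nonempty_countRoadWitnessT3bWTVS_of_histReading`;
`DecidableEq` of the index type is the reading's.  NE7b NOT proved; count 0∕9. [folklore] -/
theorem continuumYM4Torus_of_histReading_fsc (D : FiniteEpsData F (Matrix.specialUnitaryGroup (Fin N) ℂ))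
    (hBA : D.IsBlockAveraged ℰ) (hE : ℰ.MeasurableE)
    (hB : B16.EndStatementBPrinted D.C) (hβ : BetaPertHyp D.βfun) (hsign : B16.SignConventions D.C)
    {C : T4PrintedShapeBanking.Consts} {O : PrintedO1s}
    {rr : ℕ} {β₀ : ℝ} (h : ThresholdOK C F.L rr β₀) (hμ : 0 < C.μ) (d n : ℕ)
    (hκ₁ : (d : ℝ) * Real.log F.L + 2 * Real.log 2 ≤ C.κ₁) (hE₀ : Real.log (2 + birthMass C) ≤ C.E₀)
    (hA₀ : 1 ≤ C.A₀) (hβ₀ : 0 < β₀) (hLβ : (F.L : ℝ) * β₀ ≤ 1) (hn₁ : 13 ≤ C.n₁) (hn : 0 < n)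
    {θ θv : ℝ} (hθ : 0 ≤ θ) (hslack : C.a + (θ + θv) ≤ O.γ₀ * O.A₁ ^ 2 / 2)
    (hE₂ : 0 < C.E₂) (hE₃ : 0 ≤ C.E₃) {sS : ℕ} (hsS : 1 ≤ sS)
    (hsmall : (((2 * cth 32 1 sS + 1) ^ d : ℕ) : ℝ) * (5 : ℝ) ^ d * ((max 1 (2 * 32 + 2) : ℕ) : ℝ) ≤
      (F.L : ℝ) ^ (sS / 2) / 2)
    {θc : ℝ} (hθc0 : 0 ≤ θc) (hθc1 : θc < 1) (hθcs : 1 / 2 ≤ θc ^ sS)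
    (hθJ : (2 +
            ((2 * (((2 * cth 32 1 sS + 1) ^ d : ℕ) : ℝ) * ((((2 * 32 + 1) ^ d : ℕ) : ℝ) * (4 * 2 ^ d)) +
                  4 * ((((2 * cth 32 1 sS + 1) ^ d : ℕ) : ℝ) * (5 : ℝ) ^ d)) / (1 - θc) +
              2 * (2 * ((((2 * cth 32 1 sS + 1) ^ d : ℕ) : ℝ) * (5 : ℝ) ^ d))) +
            (2 * ((0 + 2 * Real.log (2 * d + 1)) + (2 * (d : ℝ) + 2 * Real.log (2 * d + 1)) *
                  (((max 1 (2 * 32 + 2) : ℕ) : ℝ) * (2 * ((((2 * cth 32 1 sS + 1) ^ d : ℕ) : ℝ) * (5 : ℝ) ^ d)))) +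
              (2 * (d : ℝ) + 2 * Real.log (2 * d + 1)) * 1 *
                (((max 1 (2 * 32 + 2) : ℕ) : ℝ) *
                    ((2 * (((2 * cth 32 1 sS + 1) ^ d : ℕ) : ℝ) * ((((2 * 32 + 1) ^ d : ℕ) : ℝ) * (4 * 2 ^ d)) +
                        4 * ((((2 * cth 32 1 sS + 1) ^ d : ℕ) : ℝ) * (5 : ℝ) ^ d)) / (1 - θc)) +
                  4 * 2 ^ d)) +
            10) + 8 * 2 ^ d * Real.log (2 * d + 1) ≤ θ)
    (hRead : T4ContinuumYM4Torus.ForSmallCouplings D fun g₀ => ∀ os : List (ULoop F),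
        ∃ (DomK : ℕ → Type) (I : (K : ℕ) → HIndex (DomK K)) (_ : DecidableEq (HIndex.Idx I)) (DomK' : ℕ → Type)
          (I' : (K : ℕ) → HIndex (DomK' K)) (X : ℕ → Type) (_ : ∀ K, MeasurableSpace (X K))
          (μ : (K : ℕ) → Measure (X K)) (_ : ∀ K, IsFiniteMeasure (μ K)) (𝒢 : (K : ℕ) → GoodClass (X K))
          (Y : ℕ → Type) (_ : ∀ K, MeasurableSpace (Y K)) (νB : (K : ℕ) → Measure (Y K))
          (_ : ∀ K, IsFiniteMeasure (νB K)) (𝒢' : (K : ℕ) → GoodClass (Y K)),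
          Nonempty (HistReadData D C O θv rr d n hn g₀ os I I' X μ 𝒢 Y νB 𝒢')) :
    T4ContinuumYM4Torus.ContinuumYM4Torus D :=
  continuumYM4Torus_of_countRoadT3bWTVS_fsc D hBA hE hB hβ hsign h hμ d n hκ₁ hE₀ hA₀ hβ₀ hLβ hn₁ hn hθ hslack hE₂ hE₃
    hsS hsmall hθc0 hθc1 hθcs hθJ
    (hRead.mono fun g₀ hg os => by
      obtain ⟨DomK, I, iI, DomK', I', X, mX, μ, hμf, 𝒢, Y, mY, νB, hνf, 𝒢', ⟨Dd⟩⟩ := hg os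
      exact ⟨HIndex.Idx I, ℕ × Lab d, Lab d, iI, inferInstance, inferInstance,
        nonempty_countRoadWitnessT3bWTVS_of_histReading Dd⟩)

end SU

end

end Summit.QuantumFields.BalabanUV.T4Continuum.HistoryRealiseCellsRunAssemblyWTVS
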